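import Mathlib
import Summits.ValiantsHypothesis.ValiantsHypothesis.Theorems.RigidityForcesSymmetryRankRigidMinimalReprLaplaceFiveSectorSplitDefs
import Summits.ValiantsHypothesis.ValiantsHypothesis.Theorems.RigidityForcesSymmetryRankRigidMinimalReprLaplaceFiveThreeSplit
import Summits.ValiantsHypothesis.ValiantsHypothesis.Theorems.RigidityForcesSymmetryRankRigidMinimalReprLaplaceFiveFourSplitTypes
import Summits.ValiantsHypothesis.ValiantsHypothesis.Theorems.RigidityForcesSymmetryRankRigidMinimalReprLaplaceFiveSymmetricPieces

/-!
# ValiantsHypothesis / RigidityForcesSymmetry — crux `LaplaceOptimalFive` (stmt-ValiantsHypothesis-24813), crux idea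
`young-shadow` (K1): FOUR-SPLIT SEPARATION on every RIGID four-edge support (general slot labels).

Shadows are indexed by their pair split (`Z : Finset (Fin 5) → ((Fin 5 → Fin 5) → ℂ)`, read on a support
`I : Finset (Finset (Fin 5))` of four distinct pair splits).  If the support is none of the three SLACK graphs — not a star
`K₁,₄` (no slot common to all four splits), not `K₃ ⊔ K₂` (no split disjoint from the other three), not the cycle `C₄` (not
every slot meets `0` or `2` of the splits) — i.e. it is a path `P₅`, a paw or a chair, then side-symmetric shadows with fully
symmetric sum are all fully symmetric.  Proof: relabel one split to `{0,1}` (`family_transport`), classify the other three under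
the stabiliser of `{0,1}` into eight normal forms (`classify4_stab01`, `decide`), each of which is one of the three normalized
rigid quadruples of ✓ `LaplaceFiveFourSplitTypes` up to a further relabelling.

Honest framing.  The RIGID half of young-shadow's K1 at four splits; the slack supports (`K₁,₄`, `C₄`, `K₃ ⊔ K₂`, ≥ 5 splits),
K1 `SideSymLaplaceOptimalFive` itself, `LaplaceOptimalFive` (OPEN · CONTESTED 72/120), `RankRigidMinimalRepr`, `VP ≠ VNP` are NOT
proved.  No definitions, no `sorry`; Mathlib + tree only.
-/

set_option linter.dupNamespace false

namespace Summit.ValiantsHypothesis.ValiantsHypothesis.Theorems.RigidityForcesSymmetryRankRigidMinimalRepr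

namespace LaplaceFiveFourSplit

open Finset LaplaceFiveSectorSplit LaplaceFiveThreeSplit LaplaceFiveFourSplitTypes

/-- Relabelling and un-relabelling a split. [folklore] -/
theorem map_symm_map (A : Finset (Fin 5)) (σ : Equiv.Perm (Fin 5)) :
    (A.map σ.toEmbedding).map σ.symm.toEmbedding = A := by
  ext x
  simp only [Finset.mem_map_equiv, Equiv.symm_symm, Equiv.symm_apply_apply]

/-- **Family transport.**  If the relabelled family separates on the relabelled support, the family separates. [folklore] -/
theorem family_transport (I : Finset (Finset (Fin 5))) (σ : Equiv.Perm (Fin 5))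
    (hsep : ∀ W : Finset (Fin 5) → ((Fin 5 → Fin 5) → ℂ),
      (∀ B ∈ I.image (fun A => A.map σ.toEmbedding), SlotInvariantOn B (W B) ∧ SlotInvariantOn Bᶜ (W B)) →
      SlotInvariantOn Finset.univ (∑ B ∈ I.image (fun A => A.map σ.toEmbedding), W B) →
      ∀ B ∈ I.image (fun A => A.map σ.toEmbedding), SlotInvariantOn Finset.univ (W B))
    (Z : Finset (Fin 5) → ((Fin 5 → Fin 5) → ℂ))
    (hZ : ∀ A ∈ I, SlotInvariantOn A (Z A) ∧ SlotInvariantOn Aᶜ (Z A))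
    (hsum : SlotInvariantOn Finset.univ (∑ A ∈ I, Z A)) :
    ∀ A ∈ I, SlotInvariantOn Finset.univ (Z A) := by
  classical
  set W : Finset (Fin 5) → ((Fin 5 → Fin 5) → ℂ) := fun B v => Z (B.map σ.symm.toEmbedding) (v ∘ ⇑σ) with hW
  have hWA : ∀ A : Finset (Fin 5), W (A.map σ.toEmbedding) = fun v => Z A (v ∘ ⇑σ) := by
    intro A; funext v; simp only [hW, map_symm_map]
  have hinj : Set.InjOn (fun A : Finset (Fin 5) => A.map σ.toEmbedding) ↑I :=
    fun A _ A' _ h => Finset.map_injective _ h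
  have h1 : ∀ B ∈ I.image (fun A => A.map σ.toEmbedding), SlotInvariantOn B (W B) ∧ SlotInvariantOn Bᶜ (W B) := by
    intro B hB
    obtain ⟨A, hA, rfl⟩ := Finset.mem_image.mp hB
    rw [hWA]
    exact sideInv_transport A (Z A) σ (hZ A hA)
  have h2 : SlotInvariantOn Finset.univ (∑ B ∈ I.image (fun A => A.map σ.toEmbedding), W B) := by
    rw [Finset.sum_image hinj]
    have e : (∑ A ∈ I, W (A.map σ.toEmbedding)) = fun v => (∑ A ∈ I, Z A) (v ∘ ⇑σ) := by
      funext v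
      simp only [Finset.sum_apply, hWA]
    rw [e]
    have := slotInv_transport Finset.univ (∑ A ∈ I, Z A) σ hsum
    rwa [Finset.map_univ_equiv] at this
  intro A hA
  have h3 := hsep W h1 h2 (A.map σ.toEmbedding) (Finset.mem_image_of_mem _ hA)
  rw [hWA] at h3
  exact full_transport_back (Z A) σ h3

/-- Family form of the normalized path separation. [folklore] -/
theorem sep4_path (Z : Finset (Fin 5) → ((Fin 5 → Fin 5) → ℂ))
    (hZ : ∀ A ∈ ({{1, 2}, {0, 1}, {2, 3}, {3, 4}} : Finset (Finset (Fin 5))), SlotInvariantOn A (Z A) ∧ SlotInvariantOn Aᶜ (Z A))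
    (hsum : SlotInvariantOn Finset.univ (∑ A ∈ ({{1, 2}, {0, 1}, {2, 3}, {3, 4}} : Finset (Finset (Fin 5))), Z A)) :
    ∀ A ∈ ({{1, 2}, {0, 1}, {2, 3}, {3, 4}} : Finset (Finset (Fin 5))), SlotInvariantOn Finset.univ (Z A) := by
  rw [Finset.sum_insert (by decide), Finset.sum_insert (by decide), Finset.sum_pair (by decide)] at hsum
  rw [show Z {1, 2} + (Z {0, 1} + (Z {2, 3} + Z {3, 4})) = Z {1, 2} + Z {0, 1} + Z {2, 3} + Z {3, 4} from by abel] at hsum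
  obtain ⟨h1, h2, h3, h4⟩ := fourSplit_separation_path _ _ _ _ (hZ _ (by simp)) (hZ _ (by simp)) (hZ _ (by simp))
    (hZ _ (by simp)) hsum
  intro A hA
  simp only [Finset.mem_insert, Finset.mem_singleton] at hA
  rcases hA with rfl | rfl | rfl | rfl
  · exact h1
  · exact h2
  · exact h3
  · exact h4

/-- Family form of the normalized paw separation. [folklore] -/
theorem sep4_paw (Z : Finset (Fin 5) → ((Fin 5 → Fin 5) → ℂ))
    (hZ : ∀ A ∈ ({{2, 3}, {0, 1}, {0, 2}, {1, 2}} : Finset (Finset (Fin 5))), SlotInvariantOn A (Z A) ∧ SlotInvariantOn Aᶜ (Z A))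
    (hsum : SlotInvariantOn Finset.univ (∑ A ∈ ({{2, 3}, {0, 1}, {0, 2}, {1, 2}} : Finset (Finset (Fin 5))), Z A)) :
    ∀ A ∈ ({{2, 3}, {0, 1}, {0, 2}, {1, 2}} : Finset (Finset (Fin 5))), SlotInvariantOn Finset.univ (Z A) := by
  rw [Finset.sum_insert (by decide), Finset.sum_insert (by decide), Finset.sum_pair (by decide)] at hsum
  rw [show Z {2, 3} + (Z {0, 1} + (Z {0, 2} + Z {1, 2})) = Z {2, 3} + Z {0, 1} + Z {0, 2} + Z {1, 2} from by abel] at hsum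
  obtain ⟨h1, h2, h3, h4⟩ := fourSplit_separation_paw _ _ _ _ (hZ _ (by simp)) (hZ _ (by simp)) (hZ _ (by simp))
    (hZ _ (by simp)) hsum
  intro A hA
  simp only [Finset.mem_insert, Finset.mem_singleton] at hA
  rcases hA with rfl | rfl | rfl | rfl
  · exact h1
  · exact h2
  · exact h3
  · exact h4

/-- Family form of the normalized chair separation. [folklore] -/
theorem sep4_chair (Z : Finset (Fin 5) → ((Fin 5 → Fin 5) → ℂ))
    (hZ : ∀ A ∈ ({{0, 3}, {0, 1}, {0, 2}, {3, 4}} : Finset (Finset (Fin 5))), SlotInvariantOn A (Z A) ∧ SlotInvariantOn Aᶜ (Z A))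
    (hsum : SlotInvariantOn Finset.univ (∑ A ∈ ({{0, 3}, {0, 1}, {0, 2}, {3, 4}} : Finset (Finset (Fin 5))), Z A)) :
    ∀ A ∈ ({{0, 3}, {0, 1}, {0, 2}, {3, 4}} : Finset (Finset (Fin 5))), SlotInvariantOn Finset.univ (Z A) := by
  rw [Finset.sum_insert (by decide), Finset.sum_insert (by decide), Finset.sum_pair (by decide)] at hsum
  rw [show Z {0, 3} + (Z {0, 1} + (Z {0, 2} + Z {3, 4})) = Z {0, 3} + Z {0, 1} + Z {0, 2} + Z {3, 4} from by abel] at hsum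
  obtain ⟨h1, h2, h3, h4⟩ := fourSplit_separation_chair _ _ _ _ (hZ _ (by simp)) (hZ _ (by simp)) (hZ _ (by simp))
    (hZ _ (by simp)) hsum
  intro A hA
  simp only [Finset.mem_insert, Finset.mem_singleton] at hA
  rcases hA with rfl | rfl | rfl | rfl
  · exact h1
  · exact h2
  · exact h3
  · exact h4

/-- A relabelled support separates if its image is a normalized form that separates. [folklore] -/
theorem sep4_of_image (I N : Finset (Finset (Fin 5))) (σ : Equiv.Perm (Fin 5))
    (hN : I.image (fun A => A.map σ.toEmbedding) = N)
    (hsepN : ∀ W : Finset (Fin 5) → ((Fin 5 → Fin 5) → ℂ),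
      (∀ B ∈ N, SlotInvariantOn B (W B) ∧ SlotInvariantOn Bᶜ (W B)) → SlotInvariantOn Finset.univ (∑ B ∈ N, W B) →
      ∀ B ∈ N, SlotInvariantOn Finset.univ (W B))
    (Z : Finset (Fin 5) → ((Fin 5 → Fin 5) → ℂ))
    (hZ : ∀ A ∈ I, SlotInvariantOn A (Z A) ∧ SlotInvariantOn Aᶜ (Z A))
    (hsum : SlotInvariantOn Finset.univ (∑ A ∈ I, Z A)) : ∀ A ∈ I, SlotInvariantOn Finset.univ (Z A) := by
  refine family_transport I σ ?_ Z hZ hsum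
  rw [hN]
  exact hsepN

/-- The eight normal forms (supports containing `{0,1}`, up to the stabiliser of `{0,1}`) of rigid four-edge supports, each
separated. [folklore] -/
theorem sep4_normalForms (N : Finset (Finset (Fin 5)))
    (hN : N ∈ [({{1, 2}, {0, 1}, {2, 3}, {3, 4}} : Finset (Finset (Fin 5))), {{0, 1}, {0, 2}, {1, 3}, {3, 4}},
      {{0, 1}, {1, 2}, {1, 3}, {2, 3}}, {{0, 1}, {0, 2}, {1, 2}, {0, 3}}, {{2, 3}, {0, 1}, {0, 2}, {1, 2}},
      {{0, 3}, {0, 1}, {0, 2}, {3, 4}}, {{0, 1}, {0, 2}, {0, 3}, {1, 4}}, {{0, 1}, {0, 2}, {2, 3}, {2, 4}}])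
    (Z : Finset (Fin 5) → ((Fin 5 → Fin 5) → ℂ))
    (hZ : ∀ A ∈ N, SlotInvariantOn A (Z A) ∧ SlotInvariantOn Aᶜ (Z A))
    (hsum : SlotInvariantOn Finset.univ (∑ A ∈ N, Z A)) : ∀ A ∈ N, SlotInvariantOn Finset.univ (Z A) := by
  simp only [List.mem_cons, List.mem_nil_iff, or_false] at hN
  rcases hN with rfl | rfl | rfl | rfl | rfl | rfl | rfl | rfl
  · exact sep4_path Z hZ hsum
  · -- path with `{0,1}` inner: relabel `0 ↦ 1, 1 ↦ 2, 2 ↦ 0` onto the normalized path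
    exact sep4_of_image _ _ (Equiv.swap (0 : Fin 5) 1 * Equiv.swap (1 : Fin 5) 2) (by decide) (sep4_path) Z hZ hsum
  · -- paw with `{0,1}` pendant
    exact sep4_of_image _ _ (Equiv.swap (0 : Fin 5) 3 * Equiv.swap (1 : Fin 5) 2) (by decide) (sep4_paw) Z hZ hsum
  · -- paw with `{0,1}` a triangle edge at the attachment vertex
    exact sep4_of_image _ _ (Equiv.swap (0 : Fin 5) 2) (by decide) (sep4_paw) Z hZ hsum
  · exact sep4_paw Z hZ hsum
  · exact sep4_chair Z hZ hsum
  · -- chair with `{0,1}` the subdivided edge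
    exact sep4_of_image _ _ (Equiv.swap (1 : Fin 5) 3) (by decide) (sep4_chair) Z hZ hsum
  · -- chair with `{0,1}` the tail edge
    exact sep4_of_image _ _ (Equiv.swap (0 : Fin 5) 2 * Equiv.swap (0 : Fin 5) 3 * Equiv.swap (1 : Fin 5) 4) (by decide) (sep4_chair) Z hZ hsum

set_option synthInstance.maxHeartbeats 400000 in
set_option synthInstance.maxSize 1024 in
/-- Classification of rigid four-edge supports containing `{0,1}` under the stabiliser of `{0,1}`. [folklore] -/
theorem classify4_stab01 : ∀ B₂ ∈ [({0, 1} : Finset (Fin 5)), {0, 2}, {0, 3}, {0, 4}, {1, 2}, {1, 3}, {1, 4}, {2, 3}, {2, 4}, {3, 4}],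
    ∀ B₃ ∈ [({0, 1} : Finset (Fin 5)), {0, 2}, {0, 3}, {0, 4}, {1, 2}, {1, 3}, {1, 4}, {2, 3}, {2, 4}, {3, 4}],
    ∀ B₄ ∈ [({0, 1} : Finset (Fin 5)), {0, 2}, {0, 3}, {0, 4}, {1, 2}, {1, 3}, {1, 4}, {2, 3}, {2, 4}, {3, 4}],
    B₂ ≠ {0, 1} → B₃ ≠ {0, 1} → B₄ ≠ {0, 1} → B₂ ≠ B₃ → B₂ ≠ B₄ → B₃ ≠ B₄ →
    (¬ ∃ c : Fin 5, ∀ A ∈ insert ({0, 1} : Finset (Fin 5)) ({B₂, B₃, B₄} : Finset (Finset (Fin 5))), c ∈ A) →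
    (¬ ∃ A ∈ insert ({0, 1} : Finset (Fin 5)) ({B₂, B₃, B₄} : Finset (Finset (Fin 5))),
        ∀ B ∈ insert ({0, 1} : Finset (Fin 5)) ({B₂, B₃, B₄} : Finset (Finset (Fin 5))), B ≠ A → Disjoint A B) →
    (¬ ∀ x : Fin 5, ((insert ({0, 1} : Finset (Fin 5)) ({B₂, B₃, B₄} : Finset (Finset (Fin 5)))).filter (fun A => x ∈ A)).card = 0
        ∨ ((insert ({0, 1} : Finset (Fin 5)) ({B₂, B₃, B₄} : Finset (Finset (Fin 5)))).filter (fun A => x ∈ A)).card = 2) →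
    ∃ ρ ∈ [(1 : Equiv.Perm (Fin 5)), Equiv.swap 2 3, Equiv.swap 2 4, Equiv.swap 3 4,
        Equiv.swap 2 3 * Equiv.swap 3 4, Equiv.swap 3 4 * Equiv.swap 2 3,
        Equiv.swap 0 1, Equiv.swap 0 1 * Equiv.swap 2 3, Equiv.swap 0 1 * Equiv.swap 2 4,
        Equiv.swap 0 1 * Equiv.swap 3 4, Equiv.swap 0 1 * Equiv.swap 2 3 * Equiv.swap 3 4,
        Equiv.swap 0 1 * Equiv.swap 3 4 * Equiv.swap 2 3],
      (insert ({0, 1} : Finset (Fin 5)) ({B₂, B₃, B₄} : Finset (Finset (Fin 5)))).image (fun A => A.map ρ.toEmbedding) ∈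
      [({{1, 2}, {0, 1}, {2, 3}, {3, 4}} : Finset (Finset (Fin 5))), {{0, 1}, {0, 2}, {1, 3}, {3, 4}},
      {{0, 1}, {1, 2}, {1, 3}, {2, 3}}, {{0, 1}, {0, 2}, {1, 2}, {0, 3}}, {{2, 3}, {0, 1}, {0, 2}, {1, 2}},
      {{0, 3}, {0, 1}, {0, 2}, {3, 4}}, {{0, 1}, {0, 2}, {0, 3}, {1, 4}}, {{0, 1}, {0, 2}, {2, 3}, {2, 4}}] := by
  decide +kernel

/-- The star predicate pulls back along a relabelling. [folklore] -/
theorem star_back (I : Finset (Finset (Fin 5))) (σ : Equiv.Perm (Fin 5))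
    (h : ∃ c : Fin 5, ∀ B ∈ I.image (fun A => A.map σ.toEmbedding), c ∈ B) : ∃ c : Fin 5, ∀ A ∈ I, c ∈ A := by
  obtain ⟨c, hc⟩ := h
  refine ⟨σ.symm c, fun A hA => ?_⟩
  have := hc _ (Finset.mem_image_of_mem _ hA)
  simpa only [Finset.mem_map_equiv] using this

/-- The isolated-edge predicate pulls back along a relabelling. [folklore] -/
theorem iso_back (I : Finset (Finset (Fin 5))) (σ : Equiv.Perm (Fin 5))
    (h : ∃ B ∈ I.image (fun A => A.map σ.toEmbedding), ∀ B' ∈ I.image (fun A => A.map σ.toEmbedding), B' ≠ B → Disjoint B B') :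
    ∃ A ∈ I, ∀ A' ∈ I, A' ≠ A → Disjoint A A' := by
  obtain ⟨B, hB, hd⟩ := h
  obtain ⟨A, hA, rfl⟩ := Finset.mem_image.mp hB
  refine ⟨A, hA, fun A' hA' hne => ?_⟩
  have h1 := hd _ (Finset.mem_image_of_mem _ hA') (fun e => hne (Finset.map_injective _ e))
  exact (Finset.disjoint_map _).mp h1

/-- The degree predicate of the cycle pulls back along a relabelling. [folklore] -/
theorem cyc_back (I : Finset (Finset (Fin 5))) (σ : Equiv.Perm (Fin 5))
    (h : ∀ x : Fin 5, ((I.image (fun A => A.map σ.toEmbedding)).filter (fun A => x ∈ A)).card = 0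
      ∨ ((I.image (fun A => A.map σ.toEmbedding)).filter (fun A => x ∈ A)).card = 2) :
    ∀ y : Fin 5, (I.filter (fun A => y ∈ A)).card = 0 ∨ (I.filter (fun A => y ∈ A)).card = 2 := by
  classical
  intro y
  have e : (I.image (fun A => A.map σ.toEmbedding)).filter (fun A => σ y ∈ A)
      = (I.filter (fun A => y ∈ A)).image (fun A => A.map σ.toEmbedding) := by
    ext B
    simp only [Finset.mem_filter, Finset.mem_image]
    constructor
    · rintro ⟨⟨A, hA, rfl⟩, hy⟩
      refine ⟨A, ⟨hA, ?_⟩, rfl⟩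
      simpa only [Finset.mem_map_equiv, Equiv.symm_apply_apply] using hy
    · rintro ⟨A, ⟨hA, hy⟩, rfl⟩
      refine ⟨⟨A, hA, rfl⟩, ?_⟩
      simpa only [Finset.mem_map_equiv, Equiv.symm_apply_apply] using hy
  have hc : ((I.filter (fun A => y ∈ A)).image (fun A => A.map σ.toEmbedding)).card = (I.filter (fun A => y ∈ A)).card :=
    Finset.card_image_of_injective _ (fun A A' e => Finset.map_injective _ e)
  have := h (σ y)
  rw [e, hc] at this
  exact this

/-- **Four-split separation on rigid supports.**  Four distinct pair splits forming a path `P₅`, a paw or a chair (i.e. not a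
star, with no isolated split, not a cycle): side-symmetric shadows with fully symmetric sum are fully symmetric. [folklore] -/
theorem fourSplit_separation_rigid (I : Finset (Finset (Fin 5))) (h4 : I.card = 4) (hpair : ∀ A ∈ I, A.card = 2)
    (hstar : ¬ ∃ c : Fin 5, ∀ A ∈ I, c ∈ A) (hiso : ¬ ∃ A ∈ I, ∀ B ∈ I, B ≠ A → Disjoint A B)
    (hcyc : ¬ ∀ x : Fin 5, (I.filter (fun A => x ∈ A)).card = 0 ∨ (I.filter (fun A => x ∈ A)).card = 2)
    (Z : Finset (Fin 5) → ((Fin 5 → Fin 5) → ℂ))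
    (hZ : ∀ A ∈ I, SlotInvariantOn A (Z A) ∧ SlotInvariantOn Aᶜ (Z A))
    (hsum : SlotInvariantOn Finset.univ (∑ A ∈ I, Z A)) : ∀ A ∈ I, SlotInvariantOn Finset.univ (Z A) := by
  classical
  -- stage 1: move one split to `{0,1}`
  obtain ⟨A₁, hA₁⟩ : I.Nonempty := Finset.card_pos.mp (by omega)
  obtain ⟨p, q, hpq, hA₁e⟩ := Finset.card_eq_two.mp (hpair A₁ hA₁)
  obtain ⟨σ, hp, hq⟩ := LaplaceFiveSymmetricPieces.exists_perm_pair p q hpq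
  have e1 : A₁.map σ.toEmbedding = {0, 1} := by
    rw [hA₁e, Finset.map_insert, Finset.map_singleton]
    simp only [Equiv.coe_toEmbedding, hp, hq]
  refine family_transport I σ ?_ Z hZ hsum
  intro W hW hWsum
  set I' := I.image (fun A => A.map σ.toEmbedding) with hI'
  have hinj : Function.Injective (fun A : Finset (Fin 5) => A.map σ.toEmbedding) := fun A A' e => Finset.map_injective _ e
  have hI'card : I'.card = 4 := by rw [hI', Finset.card_image_of_injective _ hinj]; exact h4
  have h01 : ({0, 1} : Finset (Fin 5)) ∈ I' := by rw [← e1]; exact Finset.mem_image_of_mem _ hA₁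
  have hpair' : ∀ B ∈ I', B.card = 2 := by
    intro B hB
    obtain ⟨A, hA, rfl⟩ := Finset.mem_image.mp hB
    rw [Finset.card_map]; exact hpair A hA
  -- the other three splits
  have h3 : (I'.erase {0, 1}).card = 3 := by rw [Finset.card_erase_of_mem h01, hI'card]
  obtain ⟨B₂, B₃, B₄, h23, h24, h34, hE⟩ := Finset.card_eq_three.mp h3
  have hI'e : I' = insert ({0, 1} : Finset (Fin 5)) ({B₂, B₃, B₄} : Finset (Finset (Fin 5))) := by
    rw [← hE, Finset.insert_erase h01]
  have hB₂ : B₂ ∈ I'.erase {0, 1} := by rw [hE]; simp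
  have hB₃ : B₃ ∈ I'.erase {0, 1} := by rw [hE]; simp
  have hB₄ : B₄ ∈ I'.erase {0, 1} := by rw [hE]; simp
  obtain ⟨hB₂ne, hB₂I⟩ := Finset.mem_erase.mp hB₂
  obtain ⟨hB₃ne, hB₃I⟩ := Finset.mem_erase.mp hB₃
  obtain ⟨hB₄ne, hB₄I⟩ := Finset.mem_erase.mp hB₄
  -- the relabelled support is still rigid
  have hstar' : ¬ ∃ c : Fin 5, ∀ A ∈ insert ({0, 1} : Finset (Fin 5)) ({B₂, B₃, B₄} : Finset (Finset (Fin 5))), c ∈ A := by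
    rw [← hI'e]; exact fun h => hstar (star_back I σ h)
  have hiso' : ¬ ∃ A ∈ insert ({0, 1} : Finset (Fin 5)) ({B₂, B₃, B₄} : Finset (Finset (Fin 5))),
      ∀ B ∈ insert ({0, 1} : Finset (Fin 5)) ({B₂, B₃, B₄} : Finset (Finset (Fin 5))), B ≠ A → Disjoint A B := by
    rw [← hI'e]; exact fun h => hiso (iso_back I σ h)
  have hcyc' : ¬ ∀ x : Fin 5,
      ((insert ({0, 1} : Finset (Fin 5)) ({B₂, B₃, B₄} : Finset (Finset (Fin 5)))).filter (fun A => x ∈ A)).card = 0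
        ∨ ((insert ({0, 1} : Finset (Fin 5)) ({B₂, B₃, B₄} : Finset (Finset (Fin 5)))).filter (fun A => x ∈ A)).card = 2 := by
    rw [← hI'e]; exact fun h => hcyc (cyc_back I σ h)
  -- stage 2: classify and separate
  obtain ⟨ρ, -, hρ⟩ := classify4_stab01 B₂ (LaplaceFiveThreeSplit.mem_pairs_of_card_two _ (hpair' _ hB₂I))
    B₃ (LaplaceFiveThreeSplit.mem_pairs_of_card_two _ (hpair' _ hB₃I)) B₄ (LaplaceFiveThreeSplit.mem_pairs_of_card_two _ (hpair' _ hB₄I))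
    hB₂ne hB₃ne hB₄ne h23 h24 h34 hstar' hiso' hcyc'
  rw [← hI'e] at hρ
  exact family_transport I' ρ (fun V hV hVsum => sep4_normalForms _ hρ V hV hVsum) W hW hWsum

end LaplaceFiveFourSplit

end Summit.ValiantsHypothesis.ValiantsHypothesis.Theorems.RigidityForcesSymmetryRankRigidMinimalRepr
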